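import Mathlib.Analysis.Matrix.Spectrum
import Mathlib.LinearAlgebra.Matrix.Kronecker
import Mathlib.Data.ZMod.ValMinAbs
import Literature.MathematicalPhysics.QuantumLattice.TopologicalCriticalMass
import Literature.MathematicalPhysics.QuantumLattice.GrassmannIntegralProofs
import Literature.MathematicalPhysics.QuantumFieldTheory.LatticeGaugeProofs
import HarnessLib

/-!
# The even spectral localizer, its half-signature (`localizerIndex`), and the route's second Chern number

Definition request `defn-localizerIndex` (route `QuantumFields/QCD/IntegerCriticalLine`, request D2; wanted
by `CriticalLineExists`). The object is Loring–Schulz-Baldes' **spectral localizer for even index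
pairings**: for a selfadjoint invertible `H` and an even Fredholm module with Dirac operator `D`
(odd w.r.t. a grading `Γ`), `L_κ = κ D + H ⊗ Γ` (LSB (5)); its finite-volume restriction
`L_{κ,ρ} = (κ D + H ⊗ Γ)_ρ` to `Ran χ(D² ≤ ρ²)` (LSB (6)) is a finite selfadjoint matrix, invertible with
`(L_{κ,ρ})² ≥ g²/4` as soon as `‖[D, H ⊕ H]‖ ≤ g³/(12‖H‖κ)` and `ρ > 2g/κ` (`g = ‖H⁻¹‖⁻¹`, LSB Thm 2),
and the **localized index pairing** `½ Sig(L_{κ,ρ})` (LSB Def. 3) then equals the even index pairing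
`Ind(PFP + 1 - P)`, `P = χ(H < 0)` (LSB Thm 3; new proof in Lozano Viesca–Schober–Schulz-Baldes, Thm 3),
which for a (covariant family of) short-range insulator(s) on `ℓ²(ℤ^d) ⊗ ℂ^N` with
`D = ∑ⱼ X_j ⊗ γ_j` is the `d`-th Chern number `Ch_d(P)` of the Fermi projection (LSB §1.4; LSS2019 §5
Cor. 1 for `d = 2`, "also higher Chern numbers … can be calculated as the half-signature of a spectral
localizer"; Prodan–Schulz-Baldes Cor. 6.3.2 under a bulk gap, §6.5 Cor. 6.5.2 under the mobility-gap
hypothesis MBGH). The request asks for the `d = 4`, class-A instance written for the objects the route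
has — a finite Hermitian matrix on (sites of the discrete four-torus) × (internal index), minimal-image
position operators relative to a centre `x₀`, the tree's chiral-basis `γ_μ` (`euclideanGamma`) and
`γ₅` (`gammaFive`) — together with the large-volume value `chernNumberTwo β m₀` of the index of the
Hermitian Wilson–Dirac kernel `Γ₅ D_W(U, m₀, 1)` under the `SU(3)` Wilson measure, the index assignment
`ch` of `topologicalCriticalMass ch β` (`TopologicalCriticalMass.lean`, request D3).

## Contents (all definitions with bodies; every lemma proved; no named fact)

* `posEigenvalueCount`, `negEigenvalueCount`, `matrixSignature A = n₊ - n₋`, `halfSignature A = Sig/2`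
  for a Hermitian matrix over an `RCLike` field (eigenvalue counting with Mathlib's
  `Matrix.IsHermitian.eigenvalues`, as the tree's `negModes`; junk `0` off the Hermitian matrices), with
  `n₊ + n₋ ≤ N`, `n₊ + n₋ = N` when `det A ≠ 0`, `Sig ≡ N (mod 2)` and `2 · ½Sig = Sig` for invertible
  `A` of even size (`two_mul_halfSignature`), `½Sig = n₊ - N/2 = N/2 - n₋`.
* `evenSpectralLocalizer κ X Γ Γ₀ H = κ ∑ⱼ diag(X_j) ⊗ Γ_j + H ⊗ Γ₀` on `m × k` for any real diagonal
  position data `X : Fin d → m → ℝ` and Clifford datum `(Γ_j)_{j<d}`, `Γ₀` on `ℂ^k` (LSB (5)):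
  Hermitian (`isHermitian_evenSpectralLocalizer`), `= H ⊗ Γ₀` at `κ = 0`, and **the square identity**
  `L² = (κ² ∑ⱼ X_j² + H²) ⊗ 1 + κ ∑ⱼ [X_j, H] ⊗ Γ_jΓ₀` (`evenSpectralLocalizer_mul_self`, the
  computation opening LSB's proof of Thm 2).
* `torusPosition x₀ j x = valMinAbs ((x - x₀) j) ∈ (-L/2, L/2]`: the minimal-image coordinates on
  `(ℤ/Lℤ)^d`; `∑ⱼ |X_j| = dist₁(x, x₀)` (`torusDistOne` of `MobilityGap.lean`) and, on the odd torus
  `2S+1` centred at `0`, `X_j(proj v) = v_j` for `v ∈ [-S, S]^d` (`torusPosition_zero_proj`).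
* `spectralLocalizer κ H x₀ = κ ∑_{j<4} X_j ⊗ γ_j + H ⊗ γ₅` on `((ℤ/Lℤ)⁴ × ι) × Fin 4` and
  `localizerIndex κ H x₀ = halfSignature (spectralLocalizer κ H x₀) : ℤ` — THE REQUESTED NOTION — with
  hermiticity, the `κ = 0` value, the square identity (`spectralLocalizer_mul_self`, using `γ₅² = 1`,
  `γ₅γ_μ = -γ_μγ₅` proved here from the tree's entrywise identity), evenness of the size and
  `2 · localizerIndex = Sig` for an invertible localizer.
* `wilsonLocalizerIndex m₀ κ S U` (the index of `Γ₅ D_W(U, m₀, 1)`, tree `hermitianWilsonDiracFamily`,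
  on the odd torus `2S+1` centred at `0`), `IsLocalizerLimit μ m₀ ν` (for all small `κ > 0` the
  `μ_S`-probability of `index ≠ ν` tends to `0` as `S → ∞`), `chernNumberTwoOf μ m₀` (that `ν`, junk `0`
  if none), `chernNumberTwo β m₀ := chernNumberTwoOf (wilsonMeasureFamily β) m₀`; uniqueness of the
  limit for probability measures (`IsLocalizerLimit.unique`, no measurability needed: the deviation
  events are used, `measure_union_le`), `chernNumberTwoOf_eq`, `chernNumberTwo_eq`, and the junk lemmas.

## Design choices and deliberate differences from the printed objects

* FINITE `H`, NO `(·)_ρ`. LSB/LSS restrict an infinite-volume `κD + H ⊗ Γ` to `Ran χ(|D| ≤ ρ)` with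
  Dirichlet conditions; here `H` is whatever finite Hermitian matrix the caller has. Fed with the
  Dirichlet truncation `H_ρ` of an infinite-volume operator to the ball/square sample (LSB §1.4: "the
  truncation … can be made to a square … or any sample that includes the disk of radius `ρ`") and the
  coordinates as `X`, `evenSpectralLocalizer` IS `L_{κ,ρ}`. The route instead feeds the PERIODIC torus
  operator `Γ₅ D_W(U, m₀, 1)` (its gauge fields live on the torus; there is no infinite-volume operator to
  truncate) with minimal-image coordinates: on the odd torus `2S+1` this is the square sample `[-S, S]⁴`
  plus the wrap-around bonds across the seam `|X_j| = S`, where the `κ X ⊗ γ` term dominates for `S`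
  large at fixed `κ`. This torus variant is the ROUTE'S construction (request `defn-localizerIndex`); the
  cited theorems are about the Dirichlet truncation and are quoted, not transferred.
* SIGNS. `+ H ⊗ γ₅` as in LSB (5) and in the request (LSS2019 (7) has `- H ⊗ Γ`); `γ₅ = γ₀γ₁γ₂γ₃`
  is the tree's chirality matrix, whereas PSB's CCR-normalised chiral element `(-i)^{d/2} γ₁⋯γ_d` is
  `-γ₅` in this basis (§2.3). Either flip changes the sign of the index; no sign-sensitive statement
  (e.g. the free values `χ(-1)ⁿ C(3,n)`, `χ = ±1`, of PSB (2.26) / Golterman–Jansen–Kaplan on the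
  intervals cut by `m₀ ∈ {0, -2, -4, -6, -8}`) is asserted here.
* `halfSignature` is `Sig / 2` in `ℤ` (an honest half exactly when the localizer is invertible, the
  only case in which LSB define the localized index pairing; off that case the value is a documented
  junk of integer division).
* THE LIMIT. "`μ_β`-almost surely / large volume" is rendered, for a family of measures on DIFFERENT
  finite-volume spaces, as convergence in probability of the integer-valued index to a constant, for
  every sufficiently small tuning (`∀ᶠ κ in 𝓝[>] 0`, then `S → ∞`: the order of LSB (3)–(4), first `κ`
  small, then the radius large). Uniqueness of the value needs only `μ_S(univ) = 1`.
* NOT HERE (cited only): the even index pairing / Fredholm index on `ℓ²(ℤ⁴) ⊗ ℂ^N`, LSB Thm 2–3,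
  LSS2019 Thm 3 / Cor. 1, PSB Cor. 6.3.2 / 6.5.2 as named facts — stating them faithfully needs
  Fredholm operators and the noncommutative Chern character, absent from the tree; no theorem here
  claims `localizerIndex = Ch₂`.

## References

[LoringSchulzbaldes2020] §1.2 (5)–(6), Thm 2, Cor. 1, Def. 3, Thm 3, §1.4 (7)–(8), §3 ·
[LozanoviescaSchoberSchulzbaldes2019] §2 (4), §3 (7), Thms 1–3, §5 Cor. 1, §6 · [ProdanSchulzbaldes2016]
§2.2.4 (2.24)–(2.26), §2.3 (CCR), §6.2 (even Dirac operator `D_{x₀} = ∑ᵢ γ_i ⊗ (X_i + x₀,ᵢ)`), Cor. 6.3.2,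
§6.5 Cor. 6.5.2 · [GoltermanJansenKaplan1993] · [MontvayMunster1994] App. 8.1.2 (γ matrices) ·
[EdwardsHellerNarayanan1998] §1 (`Γ₅ D_W`).
-/

noncomputable section

open Matrix Finset Filter
open scoped Kronecker Topology ENNReal
open _root_.MeasureTheory

namespace Literature.MathematicalPhysics.QuantumLattice

open Literature.Probability.LatticeModels Literature.MathematicalPhysics.QuantumFieldTheory
  Literature.Barriers.QuantumFields.WilsonDeterminant

/-! ### Signature and half-signature of a Hermitian matrix -/

section Signature

variable {𝕜 : Type*} [RCLike 𝕜] {n : Type*} [Fintype n] [DecidableEq n]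

open scoped Classical in
/-- `n₊(A)`: the number of strictly positive eigenvalues of a Hermitian matrix `A`, counted with
multiplicity (Mathlib's `Matrix.IsHermitian.eigenvalues`; the count does not depend on the chosen
eigenbasis, `Matrix.IsHermitian.roots_charpoly_eq_eigenvalues`). Junk value `0` when `A` is not
Hermitian. [folklore] -/
def posEigenvalueCount (A : Matrix n n 𝕜) : ℕ :=
  if h : A.IsHermitian then (univ.filter fun i => 0 < h.eigenvalues i).card else 0

open scoped Classical in
/-- `n₋(A)`: the number of strictly negative eigenvalues of a Hermitian matrix `A`, counted with
multiplicity (as the tree's `negModes` for `Γ₅ D_W`). Junk value `0` when `A` is not Hermitian. [folklore] -/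
def negEigenvalueCount (A : Matrix n n 𝕜) : ℕ :=
  if h : A.IsHermitian then (univ.filter fun i => h.eigenvalues i < 0).card else 0

/-- **The signature** `Sig(A) = n₊(A) - n₋(A)` of a Hermitian matrix (number of positive minus number
of negative eigenvalues; Sylvester's inertia). Junk value `0` for non-Hermitian `A`.
[cite: LoringSchulzbaldes2020, §1.2–§1.3] -/
def matrixSignature (A : Matrix n n 𝕜) : ℤ :=
  (posEigenvalueCount A : ℤ) - (negEigenvalueCount A : ℕ)

/-- **The half-signature** `½ Sig(A)` as an integer (integer division; it is an honest half,
`2 * halfSignature A = matrixSignature A`, whenever `A` is an invertible Hermitian matrix of even size: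
`two_mul_halfSignature`). "As `L_{κ,ρ}` is an even-dimensional selfadjoint and invertible matrix, its
signature is indeed divisible by `2`." [cite: LoringSchulzbaldes2020, §1.3 before Def. 3] -/
def halfSignature (A : Matrix n n 𝕜) : ℤ :=
  matrixSignature A / 2

variable {A : Matrix n n 𝕜}

/-- Unfolding `n₊` at a Hermitian matrix. [folklore] -/
theorem posEigenvalueCount_eq (hA : A.IsHermitian) :
    posEigenvalueCount A = (univ.filter fun i => 0 < hA.eigenvalues i).card := by
  rw [posEigenvalueCount, dif_pos hA]

/-- Unfolding `n₋` at a Hermitian matrix. [folklore] -/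
theorem negEigenvalueCount_eq (hA : A.IsHermitian) :
    negEigenvalueCount A = (univ.filter fun i => hA.eigenvalues i < 0).card := by
  rw [negEigenvalueCount, dif_pos hA]

/-- Unfolding the signature at a Hermitian matrix. [folklore] -/
theorem matrixSignature_eq (hA : A.IsHermitian) :
    matrixSignature A =
      ((univ.filter fun i => 0 < hA.eigenvalues i).card : ℤ) -
        ((univ.filter fun i => hA.eigenvalues i < 0).card : ℕ) := by
  rw [matrixSignature, posEigenvalueCount_eq hA, negEigenvalueCount_eq hA]

/-- Junk value: `n₊ = 0` off the Hermitian matrices. [folklore] -/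
theorem posEigenvalueCount_of_not_isHermitian (hA : ¬ A.IsHermitian) : posEigenvalueCount A = 0 := by
  rw [posEigenvalueCount, dif_neg hA]

/-- Junk value: `n₋ = 0` off the Hermitian matrices. [folklore] -/
theorem negEigenvalueCount_of_not_isHermitian (hA : ¬ A.IsHermitian) : negEigenvalueCount A = 0 := by
  rw [negEigenvalueCount, dif_neg hA]

/-- Junk value: the signature is `0` off the Hermitian matrices. [folklore] -/
theorem matrixSignature_of_not_isHermitian (hA : ¬ A.IsHermitian) : matrixSignature A = 0 := by
  rw [matrixSignature, posEigenvalueCount_of_not_isHermitian hA,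
    negEigenvalueCount_of_not_isHermitian hA]
  simp

/-- `n₊ + n₋ ≤ N` (`N` the size of the matrix). [folklore] -/
theorem posEigenvalueCount_add_negEigenvalueCount_le :
    posEigenvalueCount A + negEigenvalueCount A ≤ Fintype.card n := by
  by_cases hA : A.IsHermitian
  · rw [posEigenvalueCount_eq hA, negEigenvalueCount_eq hA, ← card_union_of_disjoint]
    · exact card_le_univ _
    · exact disjoint_filter.mpr fun i _ h1 h2 => lt_asymm h1 h2
  · simp [posEigenvalueCount_of_not_isHermitian hA, negEigenvalueCount_of_not_isHermitian hA]

/-- `|Sig(A)| ≤ N`. [folklore] -/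
theorem natAbs_matrixSignature_le : (matrixSignature A).natAbs ≤ Fintype.card n := by
  have h := posEigenvalueCount_add_negEigenvalueCount_le (A := A)
  unfold matrixSignature
  omega

/-- An invertible Hermitian matrix has no zero eigenvalue. [folklore] -/
theorem eigenvalues_ne_zero_of_det_ne_zero (hA : A.IsHermitian) (hdet : A.det ≠ 0) (i : n) :
    hA.eigenvalues i ≠ 0 := by
  intro hi
  apply hdet
  rw [hA.det_eq_prod_eigenvalues]
  exact prod_eq_zero (mem_univ i) (by rw [hi]; simp)

/-- **No zero mode: `n₊ + n₋ = N`** for an invertible Hermitian matrix. [folklore] -/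
theorem posEigenvalueCount_add_negEigenvalueCount_eq (hA : A.IsHermitian) (hdet : A.det ≠ 0) :
    posEigenvalueCount A + negEigenvalueCount A = Fintype.card n := by
  have hne := eigenvalues_ne_zero_of_det_ne_zero hA hdet
  rw [posEigenvalueCount_eq hA, negEigenvalueCount_eq hA, ← card_union_of_disjoint, ← card_univ]
  · congr 1
    ext i
    simp only [mem_union, mem_filter, mem_univ, true_and, iff_true]
    rcases lt_trichotomy (hA.eigenvalues i) 0 with h | h | h
    · exact Or.inr h
    · exact absurd h (hne i)
    · exact Or.inl h
  · exact disjoint_filter.mpr fun i _ h1 h2 => lt_asymm h1 h2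

/-- **Parity of the signature**: for an invertible Hermitian matrix `Sig(A) ≡ N (mod 2)`. [folklore] -/
theorem even_matrixSignature_iff (hA : A.IsHermitian) (hdet : A.det ≠ 0) :
    Even (matrixSignature A) ↔ Even (Fintype.card n) := by
  have h := posEigenvalueCount_add_negEigenvalueCount_eq hA hdet
  rw [matrixSignature, Int.even_sub, ← Int.even_add, ← Nat.cast_add, h, Int.even_coe_nat]

/-- **The half-signature is an honest half**: `2 · ½Sig(A) = Sig(A)` for an invertible Hermitian
matrix of even size. [cite: LoringSchulzbaldes2020, §1.3 before Def. 3] -/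
theorem two_mul_halfSignature (hA : A.IsHermitian) (hdet : A.det ≠ 0) (hn : Even (Fintype.card n)) :
    2 * halfSignature A = matrixSignature A := by
  obtain ⟨k, hk⟩ := (even_matrixSignature_iff hA hdet).mpr hn
  rw [halfSignature, hk, ← two_mul, Int.mul_ediv_cancel_left _ two_ne_zero]

/-- `½Sig(A) = n₊ - N/2` for an invertible Hermitian matrix of even size `N`. [folklore] -/
theorem halfSignature_eq_posEigenvalueCount_sub (hA : A.IsHermitian) (hdet : A.det ≠ 0)
    (hn : Even (Fintype.card n)) :
    halfSignature A = (posEigenvalueCount A : ℤ) - (Fintype.card n / 2 : ℕ) := by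
  have h := posEigenvalueCount_add_negEigenvalueCount_eq hA hdet
  have h2 := two_mul_halfSignature hA hdet hn
  obtain ⟨k, hk⟩ := hn
  unfold matrixSignature at h2
  omega

/-- `½Sig(A) = N/2 - n₋` for an invertible Hermitian matrix of even size `N` (so `-½Sig = n₋ - N/2`,
the shape of the tree's `wilsonSpectralIndex`). [folklore] -/
theorem halfSignature_eq_sub_negEigenvalueCount (hA : A.IsHermitian) (hdet : A.det ≠ 0)
    (hn : Even (Fintype.card n)) :
    halfSignature A = ((Fintype.card n / 2 : ℕ) : ℤ) - negEigenvalueCount A := by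
  have h := posEigenvalueCount_add_negEigenvalueCount_eq hA hdet
  have h2 := two_mul_halfSignature hA hdet hn
  obtain ⟨k, hk⟩ := hn
  unfold matrixSignature at h2
  omega

end Signature

/-! ### Kronecker-product bookkeeping -/

section KronAux

variable {m k : Type*} {d : ℕ}

/-- Kronecker products of Hermitian matrices are Hermitian. [folklore] -/
private theorem isHermitian_kron {A : Matrix m m ℂ} {B : Matrix k k ℂ} (hA : A.IsHermitian)
    (hB : B.IsHermitian) : (A ⊗ₖ B).IsHermitian := by
  rw [IsHermitian, conjTranspose_kronecker, hA.eq, hB.eq]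

/-- `A ⊗ (-B) = -(A ⊗ B)`. [folklore] -/
private theorem kron_neg (A : Matrix m m ℂ) (B : Matrix k k ℂ) : A ⊗ₖ (-B) = -(A ⊗ₖ B) := by
  ext ⟨i, a⟩ ⟨j, b⟩
  simp [kroneckerMap_apply]

/-- `(A₁ - A₂) ⊗ B = A₁ ⊗ B - A₂ ⊗ B`. [folklore] -/
private theorem sub_kron (A₁ A₂ : Matrix m m ℂ) (B : Matrix k k ℂ) :
    (A₁ - A₂) ⊗ₖ B = A₁ ⊗ₖ B - A₂ ⊗ₖ B := by
  ext ⟨i, a⟩ ⟨j, b⟩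
  simp [kroneckerMap_apply, sub_mul]

/-- `(∑ⱼ f j) ⊗ B = ∑ⱼ (f j ⊗ B)`. [folklore] -/
private theorem sum_kron (f : Fin d → Matrix m m ℂ) (B : Matrix k k ℂ) :
    (∑ j, f j) ⊗ₖ B = ∑ j, f j ⊗ₖ B := by
  ext ⟨i, a⟩ ⟨j, b⟩
  simp [kroneckerMap_apply, Finset.sum_mul, Matrix.sum_apply]

/-- A real diagonal matrix is Hermitian. [folklore] -/
theorem isHermitian_diagonal_ofReal [DecidableEq m] (f : m → ℝ) :
    (diagonal fun a => ((f a : ℝ) : ℂ)).IsHermitian :=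
  isHermitian_diagonal_iff.mpr fun a => by simp [isSelfAdjoint_iff]

end KronAux

/-! ### The even spectral localizer of Loring–Schulz-Baldes (general Clifford datum) -/

section Localizer

variable {m k : Type*} [DecidableEq m] {d : ℕ}

/-- **The even spectral localizer** of a finite Hermitian matrix `H` (indexed by `m`) with respect
to the Dirac operator `D = ∑ⱼ X_j ⊗ Γ_j` built from commuting "position operators" `X_j`
(real diagonal matrices on `m`, `j < d`) and a Clifford datum `Γ_1, …, Γ_d` on `ℂ^k` with grading
`Γ₀`:
`L_κ(H) = κ ∑ⱼ X_j ⊗ Γ_j + H ⊗ Γ₀`, a matrix on `m × k`, with tuning parameter `κ`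
(Loring–Schulz-Baldes (5): `L_κ = κ D + H ⊗ Γ`; Lozano Viesca–Schober–Schulz-Baldes (7) use the
opposite sign `κ D - H ⊗ Γ`). Here `H` is already a finite matrix, so no further finite-volume
restriction `(·)_ρ` is taken: with `H := H_ρ`, the Dirichlet restriction of an infinite-volume
operator to the ball or square sample of radius `ρ`, and `X_j` the coordinates, this is exactly LSB's
`L_{κ,ρ}` of (6). [cite: LoringSchulzbaldes2020, §1.2 (5)–(6) and §1.4] [cite: LozanoviescaSchoberSchulzbaldes2019, §3 (7)] -/
def evenSpectralLocalizer (κ : ℝ) (X : Fin d → m → ℝ) (Γ : Fin d → Matrix k k ℂ)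
    (Γ₀ : Matrix k k ℂ) (H : Matrix m m ℂ) : Matrix (m × k) (m × k) ℂ :=
  (κ : ℂ) • ∑ j, diagonal (fun a => ((X j a : ℝ) : ℂ)) ⊗ₖ Γ j + H ⊗ₖ Γ₀

/-- At `κ = 0` the localizer is `H ⊗ Γ₀` ("clearly, `L_{κ,ρ}` is invertible with vanishing signature
when `κ = 0`"). [cite: LoringSchulzbaldes2020, §1.3] -/
theorem evenSpectralLocalizer_zero (X : Fin d → m → ℝ) (Γ : Fin d → Matrix k k ℂ)
    (Γ₀ : Matrix k k ℂ) (H : Matrix m m ℂ) : evenSpectralLocalizer 0 X Γ Γ₀ H = H ⊗ₖ Γ₀ := by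
  simp [evenSpectralLocalizer]

/-- **The spectral localizer is Hermitian** when `H`, the `Γ_j` and `Γ₀` are (`κ` is real).
[cite: LoringSchulzbaldes2020, §1.2] -/
theorem isHermitian_evenSpectralLocalizer (κ : ℝ) (X : Fin d → m → ℝ) {Γ : Fin d → Matrix k k ℂ}
    {Γ₀ : Matrix k k ℂ} {H : Matrix m m ℂ} (hΓ : ∀ j, (Γ j).IsHermitian) (hΓ₀ : Γ₀.IsHermitian)
    (hH : H.IsHermitian) : (evenSpectralLocalizer κ X Γ Γ₀ H).IsHermitian := by
  unfold evenSpectralLocalizer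
  refine IsHermitian.add (IsHermitian.smul ?_ (Complex.conj_ofReal κ)) (isHermitian_kron hH hΓ₀)
  rw [IsHermitian, conjTranspose_sum]
  exact sum_congr rfl fun j _ => (isHermitian_kron (isHermitian_diagonal_ofReal (X j)) (hΓ j)).eq

end Localizer

/-! ### The square of the localizer (Loring–Schulz-Baldes, proof of Theorem 2) -/

section LocalizerSquare

variable {m k : Type*} [Fintype m] [DecidableEq m] [Fintype k] [DecidableEq k] {d : ℕ}

/-- **The square of an even spectral localizer, abstract form.** For pairwise commuting `X_j`, a
Clifford datum `Γ_j² = 1`, `Γ_iΓ_j = -Γ_jΓ_i` (`i ≠ j`), and a grading `Γ₀² = 1`, `Γ₀Γ_j = -Γ_jΓ₀`: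
`(κ ∑ⱼ X_j ⊗ Γ_j + H ⊗ Γ₀)² = (κ² ∑ⱼ X_j² + H²) ⊗ 1 + κ ∑ⱼ [X_j, H] ⊗ Γ_jΓ₀`
— LSB's "`L² = κ² D² + (H ⊗ Γ)² + κ [D, H ⊗ 1] Γ`" with `D² = ∑ⱼ X_j² ⊗ 1`.
[cite: LoringSchulzbaldes2020, §3, proof of Thm 2 (square of the localizer)] [cite: LozanoviescaSchoberSchulzbaldes2019, §4 (square of the localizer in the proof sketch of Thm 1)] -/
theorem localizer_sq_aux (κ : ℂ) (Xd : Fin d → Matrix m m ℂ) (Γ : Fin d → Matrix k k ℂ)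
    (Γ₀ : Matrix k k ℂ) (H : Matrix m m ℂ) (hcomm : ∀ i j, Xd i * Xd j = Xd j * Xd i)
    (hsq : ∀ j, Γ j * Γ j = 1) (hanti : ∀ i j, i ≠ j → Γ i * Γ j = -(Γ j * Γ i))
    (h₀ : Γ₀ * Γ₀ = 1) (h₀anti : ∀ j, Γ₀ * Γ j = -(Γ j * Γ₀)) :
    ((κ • ∑ j, Xd j ⊗ₖ Γ j + H ⊗ₖ Γ₀) * (κ • ∑ j, Xd j ⊗ₖ Γ j + H ⊗ₖ Γ₀)) =
      (κ ^ 2 • ∑ j, Xd j * Xd j + H * H) ⊗ₖ (1 : Matrix k k ℂ) +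
        κ • ∑ j, (Xd j * H - H * Xd j) ⊗ₖ (Γ j * Γ₀) := by
  -- `D² = ∑ⱼ X_j² ⊗ 1`
  have hDD : (∑ j, Xd j ⊗ₖ Γ j) * (∑ j, Xd j ⊗ₖ Γ j) =
      ∑ j, (Xd j * Xd j) ⊗ₖ (1 : Matrix k k ℂ) := by
    have h1 : (∑ j, Xd j ⊗ₖ Γ j) * (∑ j, Xd j ⊗ₖ Γ j) =
        ∑ i, ∑ j, (Xd i * Xd j) ⊗ₖ (Γ i * Γ j) := by
      rw [sum_mul_sum]
      exact sum_congr rfl fun i _ => sum_congr rfl fun j _ => (mul_kronecker_mul _ _ _ _).symm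
    have h2 : (∑ j, Xd j ⊗ₖ Γ j) * (∑ j, Xd j ⊗ₖ Γ j) =
        ∑ i, ∑ j, (Xd j * Xd i) ⊗ₖ (Γ j * Γ i) := by
      rw [h1, sum_comm]
    have h3 : (∑ j, Xd j ⊗ₖ Γ j) * (∑ j, Xd j ⊗ₖ Γ j) + (∑ j, Xd j ⊗ₖ Γ j) * (∑ j, Xd j ⊗ₖ Γ j) =
        ∑ i, (2 : ℂ) • ((Xd i * Xd i) ⊗ₖ (1 : Matrix k k ℂ)) := by
      nth_rewrite 1 [h1]
      rw [h2, ← sum_add_distrib]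
      refine sum_congr rfl fun i _ => ?_
      rw [← sum_add_distrib, sum_eq_single i]
      · rw [hsq, two_smul]
      · intro j _ hji
        rw [hanti j i hji, hcomm j i, kron_neg, add_neg_cancel]
      · intro hi
        exact absurd (mem_univ i) hi
    calc (∑ j, Xd j ⊗ₖ Γ j) * (∑ j, Xd j ⊗ₖ Γ j)
        = (2 : ℂ)⁻¹ • ((∑ j, Xd j ⊗ₖ Γ j) * (∑ j, Xd j ⊗ₖ Γ j) +
            (∑ j, Xd j ⊗ₖ Γ j) * (∑ j, Xd j ⊗ₖ Γ j)) := by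
          rw [← two_smul ℂ ((∑ j, Xd j ⊗ₖ Γ j) * (∑ j, Xd j ⊗ₖ Γ j)), smul_smul,
            inv_mul_cancel₀ two_ne_zero, one_smul]
      _ = (2 : ℂ)⁻¹ • ∑ i, (2 : ℂ) • ((Xd i * Xd i) ⊗ₖ (1 : Matrix k k ℂ)) := by rw [h3]
      _ = ∑ j, (Xd j * Xd j) ⊗ₖ (1 : Matrix k k ℂ) := by
          rw [← smul_sum, smul_smul, inv_mul_cancel₀ two_ne_zero, one_smul]
  -- the cross terms `D (H ⊗ Γ₀) + (H ⊗ Γ₀) D = ∑ⱼ [X_j, H] ⊗ Γ_jΓ₀`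
  have hcross : (∑ j, Xd j ⊗ₖ Γ j) * (H ⊗ₖ Γ₀) + (H ⊗ₖ Γ₀) * (∑ j, Xd j ⊗ₖ Γ j) =
      ∑ j, (Xd j * H - H * Xd j) ⊗ₖ (Γ j * Γ₀) := by
    rw [sum_mul, mul_sum, ← sum_add_distrib]
    refine sum_congr rfl fun j _ => ?_
    rw [← mul_kronecker_mul, ← mul_kronecker_mul, h₀anti, kron_neg, sub_kron, sub_eq_add_neg]
  -- `(H ⊗ Γ₀)² = H² ⊗ 1`
  have hBB : (H ⊗ₖ Γ₀) * (H ⊗ₖ Γ₀) = (H * H) ⊗ₖ (1 : Matrix k k ℂ) := by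
    rw [← mul_kronecker_mul, h₀]
  rw [add_kronecker, smul_kronecker, sum_kron, ← hDD, ← hBB, ← hcross]
  set D := ∑ j, Xd j ⊗ₖ Γ j
  set B := H ⊗ₖ Γ₀
  simp only [add_mul, mul_add, smul_mul_assoc, mul_smul_comm, smul_smul, smul_add, pow_two]
  abel

/-- **The square of the even spectral localizer**:
`L_κ(H)² = (κ² ∑ⱼ X_j² + H²) ⊗ 1 + κ ∑ⱼ [X_j, H] ⊗ Γ_jΓ₀` — the localizer is bounded below by
`H² ⊗ 1` up to the commutator term, which is small for local `H` and small `κ` (the mechanism of LSB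
Thm 2 / LSS2019 Thm 1). [cite: LoringSchulzbaldes2020, §3, proof of Thm 2] [cite: LozanoviescaSchoberSchulzbaldes2019, §4 (square of the localizer in the proof sketch of Thm 1)] -/
theorem evenSpectralLocalizer_mul_self (κ : ℝ) (X : Fin d → m → ℝ) {Γ : Fin d → Matrix k k ℂ}
    {Γ₀ : Matrix k k ℂ} (hsq : ∀ j, Γ j * Γ j = 1) (hanti : ∀ i j, i ≠ j → Γ i * Γ j = -(Γ j * Γ i))
    (h₀ : Γ₀ * Γ₀ = 1) (h₀anti : ∀ j, Γ₀ * Γ j = -(Γ j * Γ₀)) (H : Matrix m m ℂ) :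
    evenSpectralLocalizer κ X Γ Γ₀ H * evenSpectralLocalizer κ X Γ Γ₀ H =
      ((κ : ℂ) ^ 2 • ∑ j, diagonal (fun a => ((X j a : ℝ) : ℂ) * ((X j a : ℝ) : ℂ)) + H * H) ⊗ₖ
          (1 : Matrix k k ℂ) +
        (κ : ℂ) • ∑ j, (diagonal (fun a => ((X j a : ℝ) : ℂ)) * H -
            H * diagonal (fun a => ((X j a : ℝ) : ℂ))) ⊗ₖ (Γ j * Γ₀) := by
  have h := localizer_sq_aux (κ : ℂ) (fun j => diagonal fun a => ((X j a : ℝ) : ℂ)) Γ Γ₀ H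
    (fun i j => by
      rw [diagonal_mul_diagonal, diagonal_mul_diagonal]
      exact congrArg _ (funext fun a => mul_comm _ _))
    hsq hanti h₀ h₀anti
  simp only [diagonal_mul_diagonal] at h
  exact h

end LocalizerSquare

/-! ### Position operators on the discrete torus (minimal-image coordinates) -/

section TorusPosition

variable {d L : ℕ}

/-- **The `j`-th position operator on the discrete torus `(ℤ/Lℤ)^d` relative to the centre `x₀`**:
the minimal-image coordinate `X_j(x) ∈ (-L/2, L/2]` of `x - x₀` (Mathlib's `ZMod.valMinAbs`). For an
odd side `L = 2S+1` and `x₀ = 0` this identifies the torus with the box `[-S, S]^d` and `X_j` with the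
`j`-th coordinate (`torusPosition_zero_proj`) — the position operators `X_j |n⟩ = n_j |n⟩` of the
localizer on the square sample `{x : |x_j| ≤ ρ}`. [cite: LoringSchulzbaldes2020, §1.4] -/
def torusPosition (x₀ : TorusSite d L) (j : Fin d) (x : TorusSite d L) : ℤ :=
  ((x - x₀) j).valMinAbs

/-- The centre has coordinates `0`. [folklore] -/
@[simp] theorem torusPosition_self (x₀ : TorusSite d L) (j : Fin d) : torusPosition x₀ j x₀ = 0 := by
  simp [torusPosition, ZMod.valMinAbs_zero]

/-- Minimal image: `|X_j(x)| ≤ L/2`. [folklore] -/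
theorem natAbs_torusPosition_le [NeZero L] (x₀ : TorusSite d L) (j : Fin d) (x : TorusSite d L) :
    (torusPosition x₀ j x).natAbs ≤ L / 2 :=
  ZMod.natAbs_valMinAbs_le _

/-- `∑ⱼ |X_j(x)|` is the periodic `ℓ¹` distance `dist₁(x, x₀)` of `MobilityGap.lean`. [folklore] -/
theorem sum_natAbs_torusPosition [NeZero L] (x₀ x : TorusSite d L) :
    ∑ j, (torusPosition x₀ j x).natAbs = torusDistOne x x₀ := by
  unfold torusDistOne torusNormOne torusPosition
  exact sum_congr rfl fun j _ => by rw [Pi.sub_apply, ZMod.valMinAbs_natAbs_eq_min]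

/-- **Fundamental domain.** On the odd torus of side `2S+1` centred at the origin, the position of the
class of `v ∈ [-S, S]^d` is `v` itself: `X_j(proj v) = v_j`. [folklore] -/
theorem torusPosition_zero_proj (S : ℕ) (v : Fin d → ℤ) (hv : ∀ i, |v i| ≤ S) (j : Fin d) :
    torusPosition (0 : TorusSite d (2 * S + 1)) j (Torus.proj (2 * S + 1) v) = v j := by
  rw [torusPosition, sub_zero, Torus.proj_apply, ZMod.valMinAbs_spec]
  have h := abs_le.mp (hv j)
  refine ⟨rfl, ?_, ?_⟩ <;> push_cast <;> omega

end TorusPosition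

/-! ### The class-A localizer in `d = 4` on the discrete four-torus and its index -/

section FourTorus

variable {L : ℕ} [NeZero L] {ι : Type*} [Fintype ι] [DecidableEq ι]

omit [NeZero L] [Fintype ι] [DecidableEq ι] in
/-- `γ₅ = diag(1, 1, -1, -1)` is Hermitian. [folklore] -/
theorem isHermitian_gammaFive : gammaFive.IsHermitian := by
  rw [gammaFive_eq_diagonal]
  exact isHermitian_diagonal_iff.mpr fun i => by fin_cases i <;> simp [isSelfAdjoint_iff]

omit [NeZero L] [Fintype ι] [DecidableEq ι] in
/-- `γ₅² = 1` (Montvay–Münster App. 8.1.2). [cite: MontvayMunster1994, App. 8.1.2] -/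
theorem gammaFive_mul_self : gammaFive * gammaFive = 1 := by
  rw [gammaFive_eq_diagonal, diagonal_mul_diagonal, ← diagonal_one]
  congr 1
  funext i
  fin_cases i <;> simp

omit [NeZero L] [Fintype ι] [DecidableEq ι] in
/-- `γ₅` anticommutes with the `γ_μ`: `γ₅ γ_μ = -γ_μ γ₅` (from the entrywise tree identity
`ε_α (γ_μ)_{αβ} ε_β = -(γ_μ)_{αβ}`). [cite: MontvayMunster1994, App. 8.1.2 (8.8)–(8.10)] -/
theorem gammaFive_mul_euclideanGamma (μ : Fin 4) :
    gammaFive * euclideanGamma μ = -(euclideanGamma μ * gammaFive) := by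
  rw [gammaFive_eq_diagonal]
  ext α β
  rw [diagonal_mul, neg_apply, mul_diagonal]
  have h := gammaFiveSign_mul_euclideanGamma_mul_gammaFiveSign μ α β
  have h1 := gammaFiveSign_mul_self β
  calc (![1, 1, -1, -1] : Fin 4 → ℂ) α * euclideanGamma μ α β
      = (![1, 1, -1, -1] : Fin 4 → ℂ) α * euclideanGamma μ α β *
          ((![1, 1, -1, -1] : Fin 4 → ℂ) β * (![1, 1, -1, -1] : Fin 4 → ℂ) β) := by rw [h1, mul_one]
    _ = -euclideanGamma μ α β * (![1, 1, -1, -1] : Fin 4 → ℂ) β := by rw [← mul_assoc, h]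
    _ = -(euclideanGamma μ α β * (![1, 1, -1, -1] : Fin 4 → ℂ) β) := neg_mul _ _

/-- **The spectral localizer of a finite Hermitian matrix `H` on the discrete four-torus** (sites
`(ℤ/Lℤ)⁴` × internal index `ι`), centred at `x₀`, tuning `κ`:
`spectralLocalizer κ H x₀ = κ ∑_{j<4} X_j ⊗ γ_j + H ⊗ γ₅`
on `((ℤ/Lℤ)⁴ × ι) × Fin 4`, where `X_j` is the minimal-image coordinate relative to `x₀`
(`torusPosition`, acting diagonally and trivially on `ι`), `γ₀, …, γ₃` are the tree's chiral-basis
Euclidean gamma matrices (`euclideanGamma`: Hermitian, `{γ_i, γ_j} = 2δ_{ij}` — an irreducible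
representation of `Cl₄` on `ℂ⁴`) and `γ₅ = γ₀γ₁γ₂γ₃ = diag(1,1,-1,-1)` (`gammaFive`) the grading.
This is the even spectral localizer `L_κ = κ D + H ⊗ Γ` of Loring–Schulz-Baldes for `d = 4`, class A,
with Dirac operator `D = ∑ⱼ X_j ⊗ γ_j` (Prodan–Schulz-Baldes' even Dirac operator `D = ∑ᵢ γ_i ⊗ X_i` of
§6.2), written for the finite matrix `H` the route has (the torus operator; LSB's
theorems concern the Dirichlet truncation `H_ρ` of an infinite-volume operator to a ball or square
sample, to which this definition applies verbatim with `H := H_ρ`). SIGN CONVENTIONS: `+ H ⊗ γ₅` as in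
LSB (LSS2019 write `- H ⊗ Γ`); PSB's CCR-normalised chiral element is `-γ₅` in this basis; either
change flips the sign of the index. [cite: LoringSchulzbaldes2020, §1.2 (5) and §1.4 (7)] [cite: ProdanSchulzbaldes2016, §6.2 (even Dirac operator `D_{x₀} = ∑ᵢ γ_i ⊗ (X_i + x₀,ᵢ)`)] [cite: LozanoviescaSchoberSchulzbaldes2019, §3 (7)] -/
def spectralLocalizer (κ : ℝ) (H : Matrix (TorusSite 4 L × ι) (TorusSite 4 L × ι) ℂ)
    (x₀ : TorusSite 4 L) : Matrix ((TorusSite 4 L × ι) × Fin 4) ((TorusSite 4 L × ι) × Fin 4) ℂ :=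
  evenSpectralLocalizer κ (fun j p => (torusPosition x₀ j p.1 : ℝ)) euclideanGamma gammaFive H

/-- **The localizer index** (Loring–Schulz-Baldes' *localized index pairing*, Def. 3): the
half-signature `½ Sig(L_κ(H, x₀)) = (n₊ - n₋)/2` of the spectral localizer of `H` on the discrete
four-torus centred at `x₀` with tuning `κ` — the finite-volume even index pairing of `H` with the Dirac
operator, equal (for the Dirichlet truncation of a gapped infinite-volume `H`, `κ` small and radius
large as in LSB (3)–(4)) to the index pairing `Ind(PFP + 1 - P)` of the Fermi projection
`P = χ(H < 0)` and hence to the `d`-th Chern number `Ch_d(P)` (LSB Thm 3 with §1.4; LSS2019 Thm 3,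
Cor. 1 for `d = 2`; the identification is CITED, not formalised here). Integer division by `2`; an
honest half whenever the localizer is invertible (`two_mul_localizerIndex`).
[cite: LoringSchulzbaldes2020, Def. 3 and Thm 3] [cite: LozanoviescaSchoberSchulzbaldes2019, Thm 3 and §5 Cor. 1] -/
def localizerIndex (κ : ℝ) (H : Matrix (TorusSite 4 L × ι) (TorusSite 4 L × ι) ℂ)
    (x₀ : TorusSite 4 L) : ℤ :=
  halfSignature (spectralLocalizer κ H x₀)

omit [NeZero L] [Fintype ι] in
/-- The spectral localizer of a Hermitian `H` is Hermitian. [cite: LoringSchulzbaldes2020, §1.2] -/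
theorem isHermitian_spectralLocalizer (κ : ℝ) {H : Matrix (TorusSite 4 L × ι) (TorusSite 4 L × ι) ℂ}
    (hH : H.IsHermitian) (x₀ : TorusSite 4 L) : (spectralLocalizer κ H x₀).IsHermitian :=
  isHermitian_evenSpectralLocalizer κ _ euclideanGamma_isHermitian isHermitian_gammaFive hH

omit [NeZero L] [Fintype ι] in
/-- At `κ = 0` the localizer is `H ⊗ γ₅` (whose signature vanishes).
[cite: LoringSchulzbaldes2020, §1.3] -/
theorem spectralLocalizer_zero (H : Matrix (TorusSite 4 L × ι) (TorusSite 4 L × ι) ℂ)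
    (x₀ : TorusSite 4 L) : spectralLocalizer 0 H x₀ = H ⊗ₖ gammaFive :=
  evenSpectralLocalizer_zero _ _ _ _

omit [DecidableEq ι] in
/-- The localizer acts on a space of dimension `4 · #sites · #ι`, which is even.
[cite: LoringSchulzbaldes2020, §1.3] -/
theorem even_card_localizerSpace :
    Even (Fintype.card ((TorusSite 4 L × ι) × Fin 4)) := by
  rw [Fintype.card_prod, Fintype.card_fin]
  exact ⟨Fintype.card (TorusSite 4 L × ι) * 2, by ring⟩

/-- **The square of the four-torus localizer**:
`L_κ(H, x₀)² = (κ² ∑ⱼ X_j² + H²) ⊗ 1 + κ ∑ⱼ [X_j, H] ⊗ γ_jγ₅`, `X_j` the minimal-image coordinates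
relative to `x₀` (acting trivially on `ι`). [cite: LoringSchulzbaldes2020, §3, proof of Thm 2] -/
theorem spectralLocalizer_mul_self (κ : ℝ) (H : Matrix (TorusSite 4 L × ι) (TorusSite 4 L × ι) ℂ)
    (x₀ : TorusSite 4 L) :
    spectralLocalizer κ H x₀ * spectralLocalizer κ H x₀ =
      ((κ : ℂ) ^ 2 • ∑ j, diagonal (fun p : TorusSite 4 L × ι =>
            ((torusPosition x₀ j p.1 : ℝ) : ℂ) * ((torusPosition x₀ j p.1 : ℝ) : ℂ)) + H * H) ⊗ₖ
          (1 : Matrix (Fin 4) (Fin 4) ℂ) +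
        (κ : ℂ) • ∑ j, (diagonal (fun p : TorusSite 4 L × ι => ((torusPosition x₀ j p.1 : ℝ) : ℂ)) * H -
            H * diagonal (fun p : TorusSite 4 L × ι => ((torusPosition x₀ j p.1 : ℝ) : ℂ))) ⊗ₖ
          (euclideanGamma j * gammaFive) :=
  evenSpectralLocalizer_mul_self κ _ euclideanGamma_mul_self (fun _ _ h => euclideanGamma_mul_of_ne h)
    gammaFive_mul_self gammaFive_mul_euclideanGamma H

/-- Unfolding: the localizer index is the half-signature of the localizer. [folklore] -/
theorem localizerIndex_eq (κ : ℝ) (H : Matrix (TorusSite 4 L × ι) (TorusSite 4 L × ι) ℂ)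
    (x₀ : TorusSite 4 L) : localizerIndex κ H x₀ = halfSignature (spectralLocalizer κ H x₀) :=
  rfl

/-- **For an invertible localizer the index is half its signature**:
`2 · localizerIndex = Sig(L_κ)`. [cite: LoringSchulzbaldes2020, §1.3 and Def. 3] -/
theorem two_mul_localizerIndex (κ : ℝ) {H : Matrix (TorusSite 4 L × ι) (TorusSite 4 L × ι) ℂ}
    (hH : H.IsHermitian) (x₀ : TorusSite 4 L) (hdet : (spectralLocalizer κ H x₀).det ≠ 0) :
    2 * localizerIndex κ H x₀ = matrixSignature (spectralLocalizer κ H x₀) :=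
  two_mul_halfSignature (isHermitian_spectralLocalizer κ hH x₀) hdet even_card_localizerSpace

/-- For an invertible localizer, `localizerIndex = n₊(L_κ) - N/2 = N/2 - n₋(L_κ)` (`N` its size).
[cite: LoringSchulzbaldes2020, Def. 3] -/
theorem localizerIndex_eq_sub_negEigenvalueCount (κ : ℝ)
    {H : Matrix (TorusSite 4 L × ι) (TorusSite 4 L × ι) ℂ} (hH : H.IsHermitian) (x₀ : TorusSite 4 L)
    (hdet : (spectralLocalizer κ H x₀).det ≠ 0) :
    localizerIndex κ H x₀ =
      ((Fintype.card ((TorusSite 4 L × ι) × Fin 4) / 2 : ℕ) : ℤ) -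
        negEigenvalueCount (spectralLocalizer κ H x₀) :=
  halfSignature_eq_sub_negEigenvalueCount (isHermitian_spectralLocalizer κ hH x₀) hdet
    even_card_localizerSpace

/-- `|localizerIndex| ≤ N/2 ≤ 2 · #sites · #ι`. [folklore] -/
theorem natAbs_localizerIndex_le (κ : ℝ) (H : Matrix (TorusSite 4 L × ι) (TorusSite 4 L × ι) ℂ)
    (x₀ : TorusSite 4 L) :
    (localizerIndex κ H x₀).natAbs ≤ Fintype.card ((TorusSite 4 L × ι) × Fin 4) := by
  have h := natAbs_matrixSignature_le (A := spectralLocalizer κ H x₀)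
  unfold localizerIndex halfSignature
  omega

end FourTorus

/-! ### The Wilson–Dirac kernel: localizer index and the route's second Chern number -/

section Wilson

/-- **The localizer index of the Hermitian Wilson–Dirac kernel** `H = Γ₅ D_W(U, m₀, r = 1)` (tree
`hermitianWilsonDiracFamily`, colour `SU(3)` fundamental) on the odd four-torus of side `2S+1`, centred
at the origin (the torus then IS the square sample `[-S, S]⁴`, `torusPosition_zero_proj`), tuning `κ`:
the route's finite-volume surrogate for the second Chern number of the Fermi projection of `H`.
(Construction of route `IntegerCriticalLine`, request `defn-localizerIndex`, assembled from the cited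
notions.) [cite: LoringSchulzbaldes2020, Def. 3 and §1.4] [cite: ProdanSchulzbaldes2016, §2.2.4 (2.24)] -/
def wilsonLocalizerIndex (m₀ κ : ℝ) (S : ℕ) (U : GaugeConfig 4 (2 * S + 1) SU3) : ℤ :=
  localizerIndex κ (hermitianWilsonDiracFamily m₀ S U) 0

/-- **`ν` is the large-volume value of the localizer index of `Γ₅ D_W(·, m₀, 1)` under the disorder
measures `μ = (μ_S)_S`** (one measure on the gauge fields of each odd torus `2S+1`): for every
sufficiently small tuning `κ > 0`, the `μ_S`-probability that the localizer index at tuning `κ` differs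
from `ν` tends to `0` as `S → ∞` — convergence in probability to the constant `ν`, the finite-volume
rendering of "almost surely equal to `ν` in the infinite-volume limit" (for a gapped covariant family the
index is a.s. constant and, for `κ` small and radius `> 2g/κ`, equal to the half-signature: LSS2019 §5,
Cor. 1; LSB Thm 2–3). The order of limits (`S → ∞` at fixed small `κ`) is that of LSB (3)–(4).
(Construction of route `IntegerCriticalLine`.) [cite: LozanoviescaSchoberSchulzbaldes2019, §5 Cor. 1] [cite: LoringSchulzbaldes2020, Thm 2 and Thm 3] -/
def IsLocalizerLimit (μ : ∀ S : ℕ, Measure (GaugeConfig 4 (2 * S + 1) SU3)) (m₀ : ℝ) (ν : ℤ) : Prop :=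
  ∀ᶠ κ in 𝓝[>] (0 : ℝ),
    Tendsto (fun S : ℕ => μ S {U | wilsonLocalizerIndex m₀ κ S U ≠ ν}) atTop (𝓝 0)

open scoped Classical in
/-- **The second Chern number of the Wilson–Dirac kernel family at bare mass `m₀` under the disorder
measures `μ`**, DEFINED as the large-volume in-probability value of the localizer index
(`IsLocalizerLimit`) when such a value exists, and the junk value `0` otherwise. Its agreement with the
noncommutative second Chern number `Ch₂(P_F)` of Prodan–Schulz-Baldes is the content of the cited index
theorems (bulk gap: LSB Thm 3 + PSB Cor. 6.3.2; mobility gap: open, cf. LSS2019 §6), not asserted here.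
(Construction of route `IntegerCriticalLine`, request `defn-localizerIndex`.)
[cite: LoringSchulzbaldes2020, Thm 3 and §1.4] [cite: ProdanSchulzbaldes2016, §6.3 Cor. 6.3.2 and §2.2.4 (2.26)] [cite: LozanoviescaSchoberSchulzbaldes2019, §5–§6] -/
def chernNumberTwoOf (μ : ∀ S : ℕ, Measure (GaugeConfig 4 (2 * S + 1) SU3)) (m₀ : ℝ) : ℤ :=
  if h : ∃ ν : ℤ, IsLocalizerLimit μ m₀ ν then h.choose else 0

/-- **`chernNumberTwo β m₀`**: the second Chern number (in the sense of `chernNumberTwoOf`) of the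
quenched family `U ↦ Γ₅ D_W(U, m₀, 1)` under the `SU(3)` Wilson measures at inverse coupling `β`
(`wilsonMeasureFamily β`, tree normalisation `β = 2/g₀²`) — the index assignment `ch` intended in
`topologicalCriticalMass ch β` (`TopologicalCriticalMass.lean`). Free case for orientation: for the
translation-invariant model (2.24) of Prodan–Schulz-Baldes in `d = 4` the second Chern numbers are
`χ(-1)ⁿ C(3,n)`, `χ = ±1` a convention-dependent sign, on the mass intervals cut by the five critical
masses ((2.26); Golterman–Jansen–Kaplan for the Wilson–Dirac family, critical bare masses
`m₀ ∈ {0, -2, -4, -6, -8}` at `r = 1`) — quoted, not proved. (Construction of route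
`IntegerCriticalLine`, request `defn-localizerIndex`.) [cite: ProdanSchulzbaldes2016, §2.2.4 (2.24)–(2.26)] [cite: GoltermanJansenKaplan1993] [cite: LoringSchulzbaldes2020, Thm 3] -/
def chernNumberTwo (β m₀ : ℝ) : ℤ :=
  chernNumberTwoOf (wilsonMeasureFamily β) m₀

variable {μ : ∀ S : ℕ, Measure (GaugeConfig 4 (2 * S + 1) SU3)} {m₀ : ℝ} {ν ν' : ℤ}

/-- **The large-volume value is unique** (probability measures): two in-probability limits of the
same integer-valued index coincide. [folklore] -/
theorem IsLocalizerLimit.unique [hμ : ∀ S, IsProbabilityMeasure (μ S)] (h : IsLocalizerLimit μ m₀ ν)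
    (h' : IsLocalizerLimit μ m₀ ν') : ν = ν' := by
  by_contra hne
  obtain ⟨κ, hκ, hκ'⟩ := (h.and h').exists
  have hsum : Tendsto (fun S : ℕ => μ S {U | wilsonLocalizerIndex m₀ κ S U ≠ ν} +
      μ S {U | wilsonLocalizerIndex m₀ κ S U ≠ ν'}) atTop (𝓝 0) := by
    simpa using hκ.add hκ'
  have hone : ∀ S : ℕ, (1 : ℝ≥0∞) ≤ μ S {U | wilsonLocalizerIndex m₀ κ S U ≠ ν} +
      μ S {U | wilsonLocalizerIndex m₀ κ S U ≠ ν'} := fun S =>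
    calc (1 : ℝ≥0∞) = μ S Set.univ := measure_univ.symm
      _ ≤ μ S ({U | wilsonLocalizerIndex m₀ κ S U ≠ ν} ∪
          {U | wilsonLocalizerIndex m₀ κ S U ≠ ν'}) := by
        refine measure_mono fun U _ => ?_
        by_cases hU : wilsonLocalizerIndex m₀ κ S U = ν
        · right
          simp only [Set.mem_setOf_eq, hU]
          exact hne
        · exact Or.inl hU
      _ ≤ _ := measure_union_le _ _
  have h10 : (1 : ℝ≥0∞) ≤ 0 := ge_of_tendsto' hsum hone
  exact absurd h10 (by simp)

/-- **`chernNumberTwoOf` takes the limit value when it exists** (probability measures). [folklore] -/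
theorem chernNumberTwoOf_eq [∀ S, IsProbabilityMeasure (μ S)] (h : IsLocalizerLimit μ m₀ ν) :
    chernNumberTwoOf μ m₀ = ν := by
  have hex : ∃ ν : ℤ, IsLocalizerLimit μ m₀ ν := ⟨ν, h⟩
  rw [chernNumberTwoOf, dif_pos hex]
  exact hex.choose_spec.unique h

/-- Junk value: `chernNumberTwoOf μ m₀ = 0` when the localizer index has no large-volume value. [folklore] -/
theorem chernNumberTwoOf_of_not_exists (h : ¬ ∃ ν : ℤ, IsLocalizerLimit μ m₀ ν) :
    chernNumberTwoOf μ m₀ = 0 := by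
  rw [chernNumberTwoOf, dif_neg h]

/-- **`chernNumberTwo β m₀ = ν` as soon as `ν` is the large-volume value of the localizer index under
the Wilson measures at `β`** (these are probability measures, `isProbabilityMeasure_wilsonMeasure`). [folklore] -/
theorem chernNumberTwo_eq {β : ℝ} (h : IsLocalizerLimit (wilsonMeasureFamily β) m₀ ν) :
    chernNumberTwo β m₀ = ν :=
  haveI : ∀ S, IsProbabilityMeasure (wilsonMeasureFamily β S) := fun _ =>
    isProbabilityMeasure_wilsonMeasure _ (continuous_fundamentalRep (Fin 3)) β
  chernNumberTwoOf_eq h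

/-- Junk value for the quenched line. [folklore] -/
theorem chernNumberTwo_of_not_exists {β : ℝ}
    (h : ¬ ∃ ν : ℤ, IsLocalizerLimit (wilsonMeasureFamily β) m₀ ν) : chernNumberTwo β m₀ = 0 :=
  chernNumberTwoOf_of_not_exists h

end Wilson

end Literature.MathematicalPhysics.QuantumLattice

end
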